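import Mathlib
import Summits.ValiantsHypothesis.ValiantsHypothesis.Theorems.BarrierLeverPartitionMinorsHitByVPHiddenStatesSecondShellMasterTemplate
import Summits.ValiantsHypothesis.ValiantsHypothesis.Theorems.BarrierLeverPartitionMinorsHitByVPHiddenStatesSecondShellNestedRows
import Summits.ValiantsHypothesis.ValiantsHypothesis.Theorems.BarrierLeverPartitionMinorsHitByVPHiddenStatesSecondShellPrescribed

/-!
# Route BarrierLever — item `PartitionMinorsHitByVP` (stmt-ValiantsHypothesis-19717), line `hidden-states`:
# ★★ A CELL THROUGH THE MASTER TEMPLATE — the half-crossed (2,2) classes (every `t, h`)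

Helper file (`--supports stmt-ValiantsHypothesis-19717`; cell valiant-natproofs, 𝒟-side door (c), registered line
`Cruxes/PartitionMinorsHitByVP/Lines/hidden_states.lean` v9; prover seat val-np-p6 gen 19).  Closes NO item; definition-free.

PURPOSE.  The first cell obtained by DISCHARGING THE COMBINATORIAL HYPOTHESIS of the master cell template
(`…SecondShellMasterTemplate.exists_table_secondShell_of_noReduced`): no identity, no row bookkeeping — only «every configuration along the
edges has an active token».  THE CLASS: `C₁∖A₁ = {p, q}`, `C₂∖A₂ = {v, w}` with `p ∈ A₂ ∩ C₂`, `v ∈ A₁ ∩ C₁` (each swap's bottom inert in the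
other), `q ∉ A₂ ∪ C₂`, `w ∉ A₁`, and the attachment of swap 1 outside `C₂` (t = 2 representative {01,02;123,124}, the «two unfed tokens» class of
gen 17).  Orientation: path 1 = (p < q), path 2 = (v < w); union digraph `q → p → x`, `w → v → x'`.  For `D(A₁ ← C₂)`: the token `w` (read by
nobody, outside `A₁`) is active unless it collides with a staying `v`; then the token `p` (outside `A₁`, hit by nobody inside `C₂`) is active —
★★ `exists_table_secondShell_halfCrossed`.

HONEST LABEL: conjecture-column cell (second shell, every `t, h`); 19717 stays OPEN; nothing on crux 14610 or VP ≠ VNP.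
-/

set_option linter.dupNamespace false

namespace Summit.ValiantsHypothesis.ValiantsHypothesis.Theorems.BarrierLever.HiddenStates

open Finset

noncomputable section

namespace SecondShell

open PathTable

/-- the edges of a `k = 1` path table: the bottom reads its attachment, the top reads the bottom, nobody else reads. -/
theorem path₁_edges {h j j' : ℕ} (A C : Finset (Fin h)) (e : (Fin (1 + 1) ⊕ Fin 1) ⊕ (Fin j ⊕ Fin j') ≃ Fin h)
    (m1 : ∀ b, e (Sum.inl (Sum.inl b)) ∈ C \ A) {y₀ y₁ x₀ : Fin h}
    (h0 : e (Sum.inl (Sum.inl 0)) = y₀) (h1 : e (Sum.inl (Sum.inl (Fin.last 1))) = y₁) (hx : e (Sum.inl (Sum.inr 0)) = x₀)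
    (hY : C \ A = {y₀, y₁}) (u d : Fin h) (hud : u ≠ d) (hne : swapTable' e u d ≠ 0) :
    (u = y₀ ∧ d = x₀) ∨ (u = y₁ ∧ d = y₀) := by
  by_cases hu0 : u = y₀
  · left; refine ⟨hu0, ?_⟩
    have hr := row₁_bot e 0 d
    rw [h0, hx] at hr
    rw [hu0, hr, if_neg (fun h' => hud (hu0.trans h'.symm))] at hne
    by_contra hd; rw [if_neg hd] at hne; exact hne (by ring)
  by_cases hu1 : u = y₁
  · right; refine ⟨hu1, ?_⟩
    have hr := row₁_top e d
    rw [h1, h0] at hr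
    rw [hu1, hr, if_neg (fun h' => hud (hu1.trans h'.symm))] at hne
    by_contra hd; rw [if_neg hd] at hne; exact hne (by ring)
  · exfalso
    have hu : u ∉ C \ A := by rw [hY]; simp [hu0, hu1]
    rw [row_unit A C e m1 hu d, if_neg (Ne.symm hud)] at hne
    exact hne rfl

set_option maxHeartbeats 400000 in
/-- ★★ **SECOND SHELL, HALF-CROSSED (2,2) CLASSES, EVERY `t, h`** — via the master template. -/
theorem exists_table_secondShell_halfCrossed (h t : ℕ) (A₁ A₂ C₁ C₂ : Finset (Fin h))
    (hA₁ : A₁.card = t) (hA₂ : A₂.card = t) (hC₁ : C₁.card = t + 1) (hC₂ : C₂.card = t + 1)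
    (h₁ : ¬ A₁ ⊆ C₁) (h₂ : ¬ A₂ ⊆ C₂) (hA : A₁ ≠ A₂) (hC : C₁ ≠ C₂)
    {yp yq yv yw : Fin h} (hY₁ : C₁ \ A₁ = {yp, yq}) (hY₂ : C₂ \ A₂ = {yv, yw}) (hpq : yp ≠ yq) (hvw : yv ≠ yw)
    (hpA : yp ∈ A₂) (hpC : yp ∈ C₂) (hvA : yv ∈ A₁) (hvC : yv ∈ C₁) (hqA : yq ∉ A₂) (hqC : yq ∉ C₂) (hwA : yw ∉ A₁)
    (hX₁ : ∀ x ∈ A₁ \ C₁, x ∉ C₂)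
    {r : ℕ} (u cols : Fin r → Finset (Fin h)) (hu : Function.Injective u)
    (hU : ∀ i, ((u i).card ≤ t ∧ u i ≠ A₁ ∧ u i ≠ A₂) ∨ u i = C₁ ∨ u i = C₂)
    (hcols : ∀ J : Finset (Fin h), J.card ≤ t → ∃ kk, cols kk = J) :
    ∃ tx : Option (Fin h) → Fin h → ℂ,
      (Matrix.of fun i kk : Fin r => ∏ a ∈ u i, (tx none a + ∑ q ∈ cols kk, tx (some q) a)).det ≠ 0 := by
  classical
  obtain ⟨k₁, j₁, j₁', hk₁, hkj₁, a1, a2, a3, a4⟩ := swap_sizes A₁ C₁ hA₁ hC₁ h₁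
  obtain ⟨k₂, j₂, j₂', hk₂, hkj₂, b1, b2, b3, b4⟩ := swap_sizes A₂ C₂ hA₂ hC₂ h₂
  have hY₁c : (C₁ \ A₁).card = 2 := by rw [hY₁, Finset.card_pair hpq]
  have hY₂c : (C₂ \ A₂).card = 2 := by rw [hY₂, Finset.card_pair hvw]
  obtain rfl : k₁ = 1 := by omega
  obtain rfl : k₂ = 1 := by omega
  obtain ⟨x, hX₁eq⟩ := Finset.card_eq_one.1 a2
  obtain ⟨x', hX₂eq⟩ := Finset.card_eq_one.1 b2
  have hx₁ : x ∈ A₁ \ C₁ := by rw [hX₁eq]; exact Finset.mem_singleton_self _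
  have hx₂ : x' ∈ A₂ \ C₂ := by rw [hX₂eq]; exact Finset.mem_singleton_self _
  obtain ⟨hxA₁, hxC₁⟩ := Finset.mem_sdiff.1 hx₁
  obtain ⟨hx'A₂, hx'C₂⟩ := Finset.mem_sdiff.1 hx₂
  have hxC₂ : x ∉ C₂ := hX₁ x hx₁
  have hyp₁ : yp ∈ C₁ \ A₁ := by rw [hY₁]; simp
  have hyq₁ : yq ∈ C₁ \ A₁ := by rw [hY₁]; simp
  have hyv₂ : yv ∈ C₂ \ A₂ := by rw [hY₂]; simp
  have hyw₂ : yw ∈ C₂ \ A₂ := by rw [hY₂]; simp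
  obtain ⟨⟨hpC₁, hpA₁⟩, ⟨hqC₁, hqA₁⟩⟩ := And.intro (Finset.mem_sdiff.1 hyp₁) (Finset.mem_sdiff.1 hyq₁)
  obtain ⟨⟨hvC₂, hvA₂⟩, ⟨hwC₂, hwA₂⟩⟩ := And.intro (Finset.mem_sdiff.1 hyv₂) (Finset.mem_sdiff.1 hyw₂)
  -- distinctness
  have hpv : yp ≠ yv := fun h' => hpA₁ (h' ▸ hvA)
  have hpw : yp ≠ yw := fun h' => hwA₂ (h' ▸ hpA)
  have hqv : yq ≠ yv := fun h' => hqA₁ (h' ▸ hvA)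
  have hqw : yq ≠ yw := fun h' => hqC (h' ▸ hwC₂)
  have hxp : x ≠ yp := fun h' => hxC₁ (h' ▸ hpC₁)
  have hxq : x ≠ yq := fun h' => hxC₁ (h' ▸ hqC₁)
  have hxv : x ≠ yv := fun h' => hxC₁ (h' ▸ hvC)
  have hxw : x ≠ yw := fun h' => hwA (h' ▸ hxA₁)
  have hx'p : x' ≠ yp := fun h' => hx'C₂ (h' ▸ hpC)
  have hx'v : x' ≠ yv := fun h' => hx'C₂ (h' ▸ hvC₂)
  have hx'w : x' ≠ yw := fun h' => hx'C₂ (h' ▸ hwC₂)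
  have hx'q : x' ≠ yq := fun h' => hqA (h' ▸ hx'A₂)
  -- transports: path 1 = (p < q) with `x` at `p`; path 2 = (v < w) with `x'` at `v`
  have hmemY₁ : ∀ i, ![yp, yq] i ∈ C₁ \ A₁ := by intro i; fin_cases i <;> assumption
  have hmemX₁ : ∀ i, ![x] i ∈ A₁ \ C₁ := by intro i; fin_cases i; exact hx₁
  have hmemY₂ : ∀ i, ![yv, yw] i ∈ C₂ \ A₂ := by intro i; fin_cases i <;> assumption
  have hmemX₂ : ∀ i, ![x'] i ∈ A₂ \ C₂ := by intro i; fin_cases i; exact hx₂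
  have hinj1 : Function.Injective ![x] := fun i i' _ => by fin_cases i; fin_cases i'; rfl
  have hinj2 : Function.Injective ![x'] := fun i i' _ => by fin_cases i; fin_cases i'; rfl
  obtain ⟨e₁, m1, m2, m3, m4, hpy₁, hpx₁⟩ := exists_equiv_prescribed A₁ C₁ a1 a2 a3 a4 _ (injective_vec2 hpq) hmemY₁ _ hinj1 hmemX₁
  obtain ⟨e₂, n1, n2, n3, n4, hpy₂, hpx₂⟩ := exists_equiv_prescribed A₂ C₂ b1 b2 b3 b4 _ (injective_vec2 hvw) hmemY₂ _ hinj2 hmemX₂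
  have he₁p : e₁ (Sum.inl (Sum.inl 0)) = yp := by rw [hpy₁]; rfl
  have he₁q : e₁ (Sum.inl (Sum.inl (Fin.last 1))) = yq := by rw [hpy₁]; rfl
  have he₁x : e₁ (Sum.inl (Sum.inr 0)) = x := by rw [hpx₁]; rfl
  have he₂v : e₂ (Sum.inl (Sum.inl 0)) = yv := by rw [hpy₂]; rfl
  have he₂w : e₂ (Sum.inl (Sum.inl (Fin.last 1))) = yw := by rw [hpy₂]; rfl
  have he₂x : e₂ (Sum.inl (Sum.inr 0)) = x' := by rw [hpx₂]; rfl
  -- the union digraph: `p → x`, `q → p`, `v → x'`, `w → v`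
  have E : ∀ a d : Fin h, a ≠ d → (swapTable' e₁ a d ≠ 0 ∨ swapTable' e₂ a d ≠ 0) →
      (a = yp ∧ d = x) ∨ (a = yq ∧ d = yp) ∨ (a = yv ∧ d = x') ∨ (a = yw ∧ d = yv) := by
    intro a d had hor
    rcases hor with h' | h'
    · rcases path₁_edges A₁ C₁ e₁ m1 he₁p he₁q he₁x hY₁ a d had h' with h'' | h''
      · exact Or.inl h''
      · exact Or.inr (Or.inl h'')
    · rcases path₁_edges A₂ C₂ e₂ n1 he₂v he₂w he₂x hY₂ a d had h' with h'' | h''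
      · exact Or.inr (Or.inr (Or.inl h''))
      · exact Or.inr (Or.inr (Or.inr h''))
  -- the potential
  let pot : Fin h → ℕ := fun z => if z = yq ∨ z = yw then 2 else if z = yp ∨ z = yv then 1 else 0
  have hpot_x : pot x = 0 := by simp only [pot, if_neg (not_or.2 ⟨hxq, hxw⟩), if_neg (not_or.2 ⟨hxp, hxv⟩)]
  have hpot_x' : pot x' = 0 := by simp only [pot, if_neg (not_or.2 ⟨hx'q, hx'w⟩), if_neg (not_or.2 ⟨hx'p, hx'v⟩)]
  have hpot_p : pot yp = 1 := by simp only [pot]; rw [if_neg (not_or.2 ⟨hpq, hpw⟩)]; simp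
  have hpot_v : pot yv = 1 := by simp only [pot]; rw [if_neg (not_or.2 ⟨Ne.symm hqv, hvw⟩)]; simp
  have hpot_q : pot yq = 2 := by simp only [pot, if_pos (Or.inl rfl)]
  have hpot_w : pot yw = 2 := by simp only [pot, if_pos (Or.inr rfl)]
  have hdag : ∀ a d, a ≠ d → (swapTable' e₁ a d ≠ 0 ∨ swapTable' e₂ a d ≠ 0) → pot d < pot a := by
    intro a d had hor
    rcases E a d had hor with ⟨rfl, rfl⟩ | ⟨rfl, rfl⟩ | ⟨rfl, rfl⟩ | ⟨rfl, rfl⟩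
    · rw [hpot_x, hpot_p]; omega
    · rw [hpot_p, hpot_q]; omega
    · rw [hpot_x', hpot_v]; omega
    · rw [hpot_v, hpot_w]; omega
  refine exists_table_secondShell_of_noReduced h t A₁ A₂ C₁ C₂ hA₁ hA₂ hC₁ hC₂ hA hC hk₁ hkj₁ hk₂ hkj₂ e₁ m1 m2 m3 m4
    e₂ n1 n2 n3 n4 pot hdag (Or.inl ?_) u cols hu hU hcols
  -- ★ no reduced configuration for `D(A₁ ← C₂)`
  intro f g hfid hfE hgE _ _ hSU himg
  -- consequences of the edge structure
  have hf_into : ∀ a ∈ C₂, ∀ d, f a = d → d ≠ a →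
      (a = yp ∧ d = x) ∨ (a = yq ∧ d = yp) ∨ (a = yv ∧ d = x') ∨ (a = yw ∧ d = yv) := by
    intro a ha d hfa hda
    have := hfE a ha (fun h' => hda (hfa ▸ h'))
    rw [hfa] at this
    exact E a d (Ne.symm hda) this
  have hg_into : ∀ a d, g a = d → d ≠ a →
      (a = yp ∧ d = x) ∨ (a = yq ∧ d = yp) ∨ (a = yv ∧ d = x') ∨ (a = yw ∧ d = yv) := by
    intro a d hga hda
    have := hgE a (fun h' => hda (hga ▸ h'))
    rw [hga] at this
    exact E a d (Ne.symm hda) this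
  -- nobody steps onto `w`, onto `q`; only `w` steps onto `v`; only `q` (not a token) steps onto `p`
  have no_into_w : ∀ a, a ≠ yw → f a ≠ yw ∧ g a ≠ yw := by
    intro a haw
    constructor
    · intro hfa
      by_cases haC : a ∈ C₂
      · rcases hf_into a haC yw hfa (Ne.symm haw) with ⟨-, h'⟩ | ⟨-, h'⟩ | ⟨-, h'⟩ | ⟨-, h'⟩
        · exact hxw h'.symm
        · exact hpw h'.symm
        · exact hx'w h'.symm
        · exact hvw h'.symm
      · exact haw ((hfid a haC).symm.trans hfa)
    · intro hga
      rcases hg_into a yw hga (Ne.symm haw) with ⟨-, h'⟩ | ⟨-, h'⟩ | ⟨-, h'⟩ | ⟨-, h'⟩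
      · exact hxw h'.symm
      · exact hpw h'.symm
      · exact hx'w h'.symm
      · exact hvw h'.symm
  have no_g_into_q : ∀ a, a ≠ yq → g a ≠ yq := by
    intro a haq hga
    rcases hg_into a yq hga (Ne.symm haq) with ⟨-, h'⟩ | ⟨-, h'⟩ | ⟨-, h'⟩ | ⟨-, h'⟩
    · exact hxq h'.symm
    · exact hpq h'.symm
    · exact hx'q h'.symm
    · exact hqv h'
  have no_f_into_q : ∀ a ∈ C₂, f a ≠ yq := by
    intro a ha hfa
    have haq : a ≠ yq := fun h' => hqC (h' ▸ ha)
    rcases hf_into a ha yq hfa (Ne.symm haq) with ⟨-, h'⟩ | ⟨-, h'⟩ | ⟨-, h'⟩ | ⟨-, h'⟩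
    · exact hxq h'.symm
    · exact hpq h'.symm
    · exact hx'q h'.symm
    · exact hqv h'
  have no_f_into_p : ∀ a ∈ C₂, a ≠ yp → f a ≠ yp := by
    intro a ha hap hfa
    rcases hf_into a ha yp hfa (Ne.symm hap) with ⟨-, h'⟩ | ⟨h', -⟩ | ⟨-, h'⟩ | ⟨-, h'⟩
    · exact hxp h'.symm
    · exact hqC (h' ▸ ha)
    · exact hx'p h'.symm
    · exact hpv h'
  have no_g_into_p : ∀ a, a ≠ yp → a ≠ yq → g a ≠ yp := by
    intro a hap haq hga
    rcases hg_into a yp hga (Ne.symm hap) with ⟨-, h'⟩ | ⟨h', -⟩ | ⟨-, h'⟩ | ⟨-, h'⟩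
    · exact hxp h'.symm
    · exact haq h'
    · exact hx'p h'.symm
    · exact hpv h'
  -- a vertex outside `A₁`, outside the image of the tokens, and entered by no path edge is a fixed point of `g`
  have fixed_of_unreachable : ∀ z, z ∉ A₁ → z ∉ C₂.image f → (∀ a, a ≠ z → g a ≠ z) → g z = z := by
    intro z hzA hzS hzg
    by_contra hgz
    have hzm : z ∈ mov g := mem_mov.2 hgz
    have hz : z ∈ (A₁ ∪ mov g) \ C₂.image f := Finset.mem_sdiff.2 ⟨Finset.mem_union_right _ hzm, hzS⟩
    rw [← himg, Finset.mem_image] at hz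
    obtain ⟨a, ha, hga⟩ := hz
    have haz : a ≠ z := by
      intro h'; rw [h'] at ha hga; exact (mem_mov.1 ha) hga |>.elim
    exact hzg a haz hga
  -- tokens in the image that lie outside `A₁` move on
  have moves_of_mem : ∀ z, z ∉ A₁ → z ∈ C₂.image f → g z ≠ z := by
    intro z hzA hzS
    rcases Finset.mem_union.1 (hSU hzS) with h' | h'
    · exact absurd h' hzA
    · exact mem_mov.1 h'
  -- the token `w`
  have hfw : f yw = yw ∨ f yw = yv := by
    by_cases h' : f yw = yw
    · exact Or.inl h'
    · rcases hf_into yw hwC₂ (f yw) rfl h' with ⟨h'', -⟩ | ⟨h'', -⟩ | ⟨h'', -⟩ | ⟨-, h''⟩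
      · exact absurd h'' (Ne.symm hpw)
      · exact absurd h'' (Ne.symm hqw)
      · exact absurd h'' (Ne.symm hvw)
      · exact Or.inr h''
  have hw_nc : ∀ d, (∀ a ∈ C₂, a ≠ yw → f a ≠ d) → d ∉ (C₂.erase yw).image f := by
    intro d hd hmem
    obtain ⟨a, ha, hfa⟩ := Finset.mem_image.1 hmem
    exact hd a (Finset.mem_of_mem_erase ha) (Finset.ne_of_mem_erase ha) hfa
  rcases hfw with hfw | hfw
  · -- `w` stays: it is active
    refine ⟨yw, hwC₂, hwA, ?_, ?_⟩
    · rw [hfw]; exact hw_nc yw fun a _ haw => (no_into_w a haw).1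
    · rw [hfw]; simp only [true_iff]
      exact moves_of_mem yw hwA (Finset.mem_image.2 ⟨yw, hwC₂, hfw⟩)
  by_cases hfv : f yv = yv
  · -- `w` and `v` collide at `v`: look at the token `p`
    have hfp : f yp = yp ∨ f yp = x := by
      by_cases h' : f yp = yp
      · exact Or.inl h'
      · rcases hf_into yp hpC (f yp) rfl h' with ⟨-, h''⟩ | ⟨h'', -⟩ | ⟨h'', -⟩ | ⟨h'', -⟩
        · exact Or.inr h''
        · exact absurd h'' hpq
        · exact absurd h'' hpv
        · exact absurd h'' hpw
    have hp_nc : ∀ d, (∀ a ∈ C₂, a ≠ yp → f a ≠ d) → d ∉ (C₂.erase yp).image f := by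
      intro d hd hmem
      obtain ⟨a, ha, hfa⟩ := Finset.mem_image.1 hmem
      exact hd a (Finset.mem_of_mem_erase ha) (Finset.ne_of_mem_erase ha) hfa
    rcases hfp with hfp | hfp
    · refine ⟨yp, hpC, hpA₁, ?_, ?_⟩
      · rw [hfp]; exact hp_nc yp fun a ha hap => no_f_into_p a ha hap
      · rw [hfp]; simp only [true_iff]
        exact moves_of_mem yp hpA₁ (Finset.mem_image.2 ⟨yp, hpC, hfp⟩)
    · refine ⟨yp, hpC, hpA₁, ?_, ?_⟩
      · rw [hfp]
        refine hp_nc x fun a ha hap hfa => ?_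
        have hax : a ≠ x := fun h' => hxC₂ (h' ▸ ha)
        rcases hf_into a ha x hfa (Ne.symm hax) with ⟨h', -⟩ | ⟨-, h'⟩ | ⟨h', h''⟩ | ⟨-, h'⟩
        · exact hap h'
        · exact hxp h'
        · rw [h'] at hfa; rw [hfv] at hfa; exact hxv hfa.symm
        · exact hxv h'
      · have hpx' : f yp ≠ yp := by rw [hfp]; exact hxp
        simp only [hpx', false_iff, not_not]
        refine fixed_of_unreachable yp hpA₁ ?_ ?_
        · intro hmem
          obtain ⟨a, ha, hfa⟩ := Finset.mem_image.1 hmem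
          by_cases hap : a = yp
          · rw [hap] at hfa; exact hpx' hfa
          · exact no_f_into_p a ha hap hfa
        · intro a hap hga
          by_cases haq : a = yq
          · -- then `q` would be a non-terminal path vertex, but nobody reaches `q`
            have hgq : g yq ≠ yq := by rw [← haq, hga]; exact fun h' => hap h'.symm
            have hq_fixed := fixed_of_unreachable yq hqA₁
              (fun hmem => by
                obtain ⟨a', ha', hfa'⟩ := Finset.mem_image.1 hmem
                exact no_f_into_q a' ha' hfa')
              (fun a' ha'q => no_g_into_q a' ha'q)
            exact hgq hq_fixed
          · exact no_g_into_p a hap haq hga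
  · -- `v` stepped away: `w` is active
    refine ⟨yw, hwC₂, hwA, ?_, ?_⟩
    · rw [hfw]
      refine hw_nc yv fun a ha haw hfa => ?_
      by_cases hav : a = yv
      · exact hfv (hav ▸ hfa)
      · rcases hf_into a ha yv hfa (Ne.symm hav) with ⟨-, h'⟩ | ⟨-, h'⟩ | ⟨-, h'⟩ | ⟨h', -⟩
        · exact hxv h'.symm
        · exact hpv h'.symm
        · exact hx'v h'.symm
        · exact haw h'
    · have hwv : f yw ≠ yw := by rw [hfw]; exact hvw
      simp only [hwv, false_iff, not_not]
      refine fixed_of_unreachable yw hwA ?_ (fun a haw => (no_into_w a haw).2)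
      intro hmem
      obtain ⟨a, ha, hfa⟩ := Finset.mem_image.1 hmem
      by_cases haw : a = yw
      · rw [haw] at hfa; exact hwv hfa
      · exact (no_into_w a haw).1 hfa

end SecondShell

end

end Summit.ValiantsHypothesis.ValiantsHypothesis.Theorems.BarrierLever.HiddenStates
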